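import Summits.BirchSwinnertonDyer.BirchSwinnertonDyer.Theorems.SchneiderFreeAdditiveX3EndStateControlDischarged
import Summits.BirchSwinnertonDyer.Rank1Residual.X11b.FrameIdealRigidity
import HarnessLib

/-!
# Route `SchneiderFreeAdditiveX3` (K1 door), cruxes r2 `PotMultBranchIMC` (19176) / r3 `GordTwoBranchIMC` (19177):
# the ♭-divisibility H3♭ for EVERY frame follows from H3♭ at ONE frame (x11b3's ideal rigidity across periods)

Cell `bsd-schneider-ideate`, seat `bsd-schneider-door-c5` (prover, generation 19; assembly layer).  PARTITION: board row
B6 ∩ X3 ∩ sst-twist, `r = 1`, of `Rank1Residual.partition`; types-the-object-of nothing new; closes none of B6's cells.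
bears_on: K1-door (route-BirchSwinnertonDyer-SchneiderFreeAdditiveX3 items 19176 / 19177; FINDING-door-c5-g19 §2 (a)).

WHY.  bsd-potss-kmc g19's socket `additiveIMCLowerBDPInputManinAt_of_pt_of_kolyvagin_of_hsieh_of_lzz_of_intDiv` (p546778; with
its Poitou–Tate binder discharged: `ControlDischarged.potMultBranchIMC_of_kolyvagin_of_hsieh_of_lzz_of_intDiv` /
`…gordTwoBranchIMC_…`, p631992) reduces each branch crux to Kolyvagin + Hsieh 2014 (any level) + Liu–Zhang–Zhang 2018 (additive)
+ ONE typed analytic half, the ♭-DIVISIBILITY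

  H3♭ : over the socket's binders, for every embedding datum `ι′` inducing `𝔭` and EVERY ♭-frame `(Ω_K ≠ 0, Ω_p ≠ 0,
        Q ∈ 𝓞_{ℂ_p}⟦T⟧)` with `X11b.R1.IsBDPLFunctionInt p ι′ 𝔭 κ γ Dt.f Ω_K Ω_p Q`:
        `Ch_Λ(X_ac^∅(E_K)) · 𝓞_{ℂ_p}⟦T⟧ ⊆ (Q)`,

quantified over ALL frames (all non-zero periods).  Any source of the divisibility (Keller–Yin Thm. 3.5.1 on the (G-ord) cell read at a
matched frame; an (M)-cell argument) delivers it at ONE frame.  By x11b3's IDEAL RIGIDITY ACROSS PERIODS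
(`X11b.R1.span_singleton_eq_of_isBDPLFunctionInt`: at an odd `p`, over an imaginary quadratic `K`, for an anticyclotomic `κ` with
topological generator `γ`, two ♭-frames of the same `(ι, 𝔭, κ, γ, f)` with ARBITRARY non-zero periods generate the SAME ideal of
`𝓞_{ℂ_p}⟦T⟧`) one frame is as good as all:

* §1 `ideal_le_span_of_exists_frame` — abstract: an ideal `I ≤ (Q₀)` for ONE ♭-frame `Q₀` is `≤ (Q)` for EVERY ♭-frame `Q`.
* §2 `intDiv_of_exists_frame` — H3♭ over the socket's binders on ANY cell predicate `Cell W p` (instantiate `Additive.SubM` for r2's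
  `hM3`, `Additive.SubGordTwo` for r3's `hG3`) from its ∃-frame form H3♭∃ (same binders; after `ι′`: `∃ Ω_K Ω_p Q`, non-zero periods,
  a ♭-frame, and the divisibility at it).
* §3 the two branch cruxes from the ∃-forms: `potMultBranchIMC_of_kolyvagin_of_hsieh_of_lzz_of_exists_intDiv`,
  `gordTwoBranchIMC_of_kolyvagin_of_hsieh_of_lzz_of_exists_intDiv` (§2 fed to the Poitou–Tate-free sockets of p631992).

HONEST FRAMING: THEOREMS ONLY (no definition, no named fact, no `sorry`); pure composition of tree theorems; every statement
CONDITIONAL on its displayed hypotheses; on (M) no divisibility is in print, on (G-ord) its `R₀`-sibling is Keller–Yin Thm. 3.5.1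
(PREPRINT) and the matching of frames is NOT in the tree (FINDING-door-c5-g19 §2); nothing is closed; BSD is proved for no curve.
References: [Castella2018] Thm. 3.1 (arXiv:1704.06608 p. 9); [Hsieh2014] Thm. A; [LiuZhangZhang2018] Thm 1.5.1/1.5.3;
[KellerYin2024b] arXiv:2410.23241 Thm. 3.5.1 (preprint; shape only); [JetchevSkinnerWan2017] §7.4.1.
-/

noncomputable section

open scoped Classical

set_option autoImplicit false
-- `Summit.<P>.<Sub>` repeats `BirchSwinnertonDyer` by the tree's layout convention (D-0017)
set_option linter.dupNamespace false

open Field NumberField IsDedekindDomain WeierstrassCurve PowerSeries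
  Literature.NumberTheory.EllipticCurves Literature.NumberTheory.EllipticCurves.GreenbergSelmer
  Literature.NumberTheory.GaloisRepresentations Literature.NumberTheory.GaloisCohomology
  Literature.NumberTheory.EllipticCurves.ModularForms Literature.NumberTheory.EllipticCurves.Rank1Residual
  Summit.BirchSwinnertonDyer.Rank1Residual Summit.BirchSwinnertonDyer.Rank1Residual.X11b
  Summit.BirchSwinnertonDyer.Rank1Residual.X11b.AcSelmer Summit.BirchSwinnertonDyer.Rank1Residual.X11b.Halves
  Summit.BirchSwinnertonDyer.BirchSwinnertonDyer.Theorems.SchneiderFree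
  Summit.BirchSwinnertonDyer.BirchSwinnertonDyer.Theses.SchneiderFreeAdditiveX3

namespace Summit.BirchSwinnertonDyer.BirchSwinnertonDyer.Theorems.SchneiderFreeAdditiveX3.ControlDischarged

/-! ### §1 Abstract: divisibility at one ♭-frame is divisibility at every ♭-frame -/

/-- **An ideal contained in `(Q₀)` for ONE ♭-frame `Q₀` is contained in `(Q)` for EVERY ♭-frame `Q`** of the same
`(ι, 𝔭, κ, γ, f)` (odd `p`, `K` imaginary quadratic, `κ` anticyclotomic with topological generator `γ`, all periods non-zero):
x11b3's `R1.span_singleton_eq_of_isBDPLFunctionInt` gives `(Q) = (Q₀)`. [cite: Castella2018, Thm. 3.1 (arXiv:1704.06608 p. 9)] -/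
theorem ideal_le_span_of_exists_frame {p : ℕ} [Fact p.Prime] (hp2 : p ≠ 2) {K : Type} [Field K] [NumberField K]
    (hK : IsImaginaryQuadratic K) {N : ℕ} {ι : PadicAlgCl p ≃+* ℂ} {𝔭 : HeightOneSpectrum (𝓞 K)}
    {κ : ZpExtension K p} (hκ : κ.IsAnticyclotomic) {γ : Field.absoluteGaloisGroup K} (hγ : κ.IsTopGenerator γ)
    {f : CuspForm (CongruenceSubgroup.Gamma0 N) 2} {I : Ideal (PowerSeries 𝓞_ℂ_[p])}
    (h : ∃ (ΩK₀ : ℂ) (Ωp₀ : ℂ_[p]) (Q₀ : PowerSeries 𝓞_ℂ_[p]), ΩK₀ ≠ 0 ∧ Ωp₀ ≠ 0 ∧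
      R1.IsBDPLFunctionInt p ι 𝔭 κ γ f ΩK₀ Ωp₀ Q₀ ∧ I ≤ Ideal.span {Q₀})
    {ΩK : ℂ} {Ωp : ℂ_[p]} {Q : PowerSeries 𝓞_ℂ_[p]} (hΩK : ΩK ≠ 0) (hΩp : Ωp ≠ 0)
    (hQ : R1.IsBDPLFunctionInt p ι 𝔭 κ γ f ΩK Ωp Q) : I ≤ Ideal.span {Q} := by
  obtain ⟨ΩK₀, Ωp₀, Q₀, hΩK₀, hΩp₀, hQ₀, hI⟩ := h
  rw [← R1.span_singleton_eq_of_isBDPLFunctionInt hp2 hK hκ hγ hΩK hΩK₀ hΩp hΩp₀ hQ hQ₀]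
  exact hI

/-! ### §2 H3♭ over the socket's binders from its ∃-frame form, on any cell -/

/-- **H3♭ ⇐ H3♭∃ on any cell.** Over the binders of the socket `AdditiveIMCLowerBDPInputManinAt` restricted to a cell predicate
`Cell W p` (`Additive.SubM` for crux r2, `Additive.SubGordTwo` for crux r3): if at every datum and every embedding datum `ι′`
inducing `𝔭` there is ONE ♭-frame `Q₀` of `Dt.f` (non-zero periods) with `Ch_Λ(X_ac^∅)·𝓞_{ℂ_p}⟦T⟧ ⊆ (Q₀)`, then the divisibility
holds at EVERY ♭-frame — the hypothesis `hM3` / `hG3` of the ♭-road sockets VERBATIM.  (`p ≠ 2`, `K` imaginary quadratic and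
`κ` anticyclotomic are among the binders.)  Conditional; nothing asserted about any curve.
[cite: Castella2018, Thm. 3.1 (arXiv:1704.06608 p. 9)] [cite: JetchevSkinnerWan2017, §7.4.1 (arXiv:1512.06894 p. 30) (socket shape)] -/
theorem intDiv_of_exists_frame
    (Cell : ∀ (W : WeierstrassCurve ℚ) [W.IsElliptic] [W.IsGloballyMinimal] (p : ℕ) [Fact p.Prime], Prop)
    (hEx : ∀ (W : WeierstrassCurve ℚ) [W.IsElliptic] [W.IsGloballyMinimal] (p : ℕ) [Fact p.Prime],
      W.analyticRank = 1 → p ≠ 2 → ClassX3 W p → Cell W p →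
      ∀ (N : ℕ) [NeZero N] (K : Type) [Field K] [NumberField K]
        (Dt : ModularParametrizationData W N) (H : HeegnerDatum N (NumberField.discr K)) (ι : K →+* ℂ)
        (P : (W.baseChange K).toAffine.Point),
        W.analyticRank = 1 → Additive.N10.Locus W p → W.conductorNorm ℤ = N → IsImaginaryQuadratic K →
        Odd (NumberField.discr K) → ¬ p ∣ Units.torsionOrder K → SatisfiesHeegnerHypothesis N K →
        (W.quadraticTwist (NumberField.discr K : ℚ)).entireLFunction 1 ≠ 0 →
        WeierstrassCurve.Affine.Point.map ι.toRatAlgHom P = heegnerPointComplex Dt H →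
        ¬ IsOfFinAddOrder P →
        ∀ (κ : ZpExtension K p), κ.IsAnticyclotomic →
          ∀ (γ : Field.absoluteGaloisGroup K) [Fact (κ.IsTopGenerator γ)]
            (𝔭 : HeightOneSpectrum (𝓞 K)), ((p : ℕ) : 𝓞 K) ∈ 𝔭.asIdeal →
            𝔭.asIdeal.ramificationIdx (𝓞 ℚ) = 1 → 𝔭.asIdeal.inertiaDeg (𝓞 ℚ) = 1 →
            ∀ (ι' : PadicAlgCl p ≃+* ℂ), BranchInducesPrime p ι' 𝔭 →
              ∃ (ΩK : ℂ) (Ωp : ℂ_[p]) (Q : PowerSeries (PadicComplexInt p)), ΩK ≠ 0 ∧ Ωp ≠ 0 ∧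
                R1.IsBDPLFunctionInt p ι' 𝔭 κ γ Dt.f ΩK Ωp Q ∧
                  (XAc.charIdeal (W.baseChange K) p κ 𝔭 ∅ γ).map (PowerSeries.map (R1.toCpInt p)) ≤
                    Ideal.span {Q}) :
    ∀ (W : WeierstrassCurve ℚ) [W.IsElliptic] [W.IsGloballyMinimal] (p : ℕ) [Fact p.Prime],
      W.analyticRank = 1 → p ≠ 2 → ClassX3 W p → Cell W p →
      ∀ (N : ℕ) [NeZero N] (K : Type) [Field K] [NumberField K]
        (Dt : ModularParametrizationData W N) (H : HeegnerDatum N (NumberField.discr K)) (ι : K →+* ℂ)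
        (P : (W.baseChange K).toAffine.Point),
        W.analyticRank = 1 → Additive.N10.Locus W p → W.conductorNorm ℤ = N → IsImaginaryQuadratic K →
        Odd (NumberField.discr K) → ¬ p ∣ Units.torsionOrder K → SatisfiesHeegnerHypothesis N K →
        (W.quadraticTwist (NumberField.discr K : ℚ)).entireLFunction 1 ≠ 0 →
        WeierstrassCurve.Affine.Point.map ι.toRatAlgHom P = heegnerPointComplex Dt H →
        ¬ IsOfFinAddOrder P →
        ∀ (κ : ZpExtension K p), κ.IsAnticyclotomic →
          ∀ (γ : Field.absoluteGaloisGroup K) [Fact (κ.IsTopGenerator γ)]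
            (𝔭 : HeightOneSpectrum (𝓞 K)), ((p : ℕ) : 𝓞 K) ∈ 𝔭.asIdeal →
            𝔭.asIdeal.ramificationIdx (𝓞 ℚ) = 1 → 𝔭.asIdeal.inertiaDeg (𝓞 ℚ) = 1 →
            ∀ (ι' : PadicAlgCl p ≃+* ℂ), BranchInducesPrime p ι' 𝔭 →
              ∀ (ΩK : ℂ) (Ωp : ℂ_[p]) (Q : PowerSeries (PadicComplexInt p)), ΩK ≠ 0 → Ωp ≠ 0 →
                R1.IsBDPLFunctionInt p ι' 𝔭 κ γ Dt.f ΩK Ωp Q →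
                  (XAc.charIdeal (W.baseChange K) p κ 𝔭 ∅ γ).map (PowerSeries.map (R1.toCpInt p)) ≤
                    Ideal.span {Q} := by
  intro W _ _ p _ hr hp2 hX hC N _ K _ _ Dt H ι P hr' hloc hN hK hodd hunit hHe hL1 hP hnt κ hκ γ hγ 𝔭 h𝔭 he hf
    ι' hι' ΩK Ωp Q hΩK hΩp hQ
  exact ideal_le_span_of_exists_frame hp2 hK hκ hγ.out
    (hEx W p hr hp2 hX hC N K Dt H ι P hr' hloc hN hK hodd hunit hHe hL1 hP hnt κ hκ γ 𝔭 h𝔭 he hf ι' hι') hΩK hΩp hQ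

/-! ### §3 The two branch cruxes from the ∃-frame ♭-divisibility -/

/-- **Crux r2 `PotMultBranchIMC` (item 19176) ⇐ Kolyvagin ∧ Hsieh 2014 Thm. A (any level) ∧ Liu–Zhang–Zhang 2018 (additive) ∧ H3♭∃
on the (M) cell** (ONE ♭-frame with the divisibility per datum and `ι′`): §2 with `Cell := Additive.SubM`, fed to the
Poitou–Tate-free socket `potMultBranchIMC_of_kolyvagin_of_hsieh_of_lzz_of_intDiv` (p631992).  Conditional; on (M) no divisibility is
in print. [cite: Hsieh2014, Thm. A p. 712 (Doc. Math. 19)] [cite: LiuZhangZhang2018, Thm 1.5.1 and Thm 1.5.3 (Duke Math. J. 167 pp. 748–749)]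
[cite: KellerYin2024b, §3.1 Case II (arXiv:2410.23241 pp. 13–15) (scope statement only)] -/
theorem potMultBranchIMC_of_kolyvagin_of_hsieh_of_lzz_of_exists_intDiv
    (hKo : ∀ (N : ℕ) [NeZero N] (W : WeierstrassCurve ℚ) (K : Type) [Field K] [NumberField K],
      Literature.NumberTheory.EllipticCurves.kolyvagin N W K)
    (hA : Hsieh2014.thmA_exists_isHsiehLFunction_unrPeriod_anyLevel)
    (hL : LiuZhangZhang2018.thm151_thm153_modularCurve_heegnerVector_additive)
    (hM3 : ∀ (W : WeierstrassCurve ℚ) [W.IsElliptic] [W.IsGloballyMinimal] (p : ℕ) [Fact p.Prime],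
      W.analyticRank = 1 → p ≠ 2 → ClassX3 W p → Additive.SubM W p →
      ∀ (N : ℕ) [NeZero N] (K : Type) [Field K] [NumberField K]
        (Dt : ModularParametrizationData W N) (H : HeegnerDatum N (NumberField.discr K)) (ι : K →+* ℂ)
        (P : (W.baseChange K).toAffine.Point),
        W.analyticRank = 1 → Additive.N10.Locus W p → W.conductorNorm ℤ = N → IsImaginaryQuadratic K →
        Odd (NumberField.discr K) → ¬ p ∣ Units.torsionOrder K → SatisfiesHeegnerHypothesis N K →
        (W.quadraticTwist (NumberField.discr K : ℚ)).entireLFunction 1 ≠ 0 →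
        WeierstrassCurve.Affine.Point.map ι.toRatAlgHom P = heegnerPointComplex Dt H →
        ¬ IsOfFinAddOrder P →
        ∀ (κ : ZpExtension K p), κ.IsAnticyclotomic →
          ∀ (γ : Field.absoluteGaloisGroup K) [Fact (κ.IsTopGenerator γ)]
            (𝔭 : HeightOneSpectrum (𝓞 K)), ((p : ℕ) : 𝓞 K) ∈ 𝔭.asIdeal →
            𝔭.asIdeal.ramificationIdx (𝓞 ℚ) = 1 → 𝔭.asIdeal.inertiaDeg (𝓞 ℚ) = 1 →
            ∀ (ι' : PadicAlgCl p ≃+* ℂ), BranchInducesPrime p ι' 𝔭 →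
              ∃ (ΩK : ℂ) (Ωp : ℂ_[p]) (Q : PowerSeries (PadicComplexInt p)), ΩK ≠ 0 ∧ Ωp ≠ 0 ∧
                R1.IsBDPLFunctionInt p ι' 𝔭 κ γ Dt.f ΩK Ωp Q ∧
                  (XAc.charIdeal (W.baseChange K) p κ 𝔭 ∅ γ).map (PowerSeries.map (R1.toCpInt p)) ≤
                    Ideal.span {Q}) :
    PotMultBranchIMC :=
  potMultBranchIMC_of_kolyvagin_of_hsieh_of_lzz_of_intDiv hKo hA hL (intDiv_of_exists_frame (fun W _ _ p _ => Additive.SubM W p) hM3)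

/-- **Crux r3 `GordTwoBranchIMC` (item 19177) ⇐ Kolyvagin ∧ Hsieh 2014 Thm. A (any level) ∧ Liu–Zhang–Zhang 2018 (additive) ∧ H3♭∃
on the (G-ord, `e = 2`) cell** (ONE ♭-frame with the divisibility per datum and `ι′` — the shape a MATCHED Keller–Yin branch frame
would deliver, FINDING-door-c5-g19 §2): §2 with `Cell := Additive.SubGordTwo`, fed to the Poitou–Tate-free socket
`gordTwoBranchIMC_of_kolyvagin_of_hsieh_of_lzz_of_intDiv` (p631992).  Conditional; the matching of frames is NOT in the tree and
Keller–Yin Thm. 3.5.1 is a PREPRINT. [cite: Hsieh2014, Thm. A p. 712 (Doc. Math. 19)]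
[cite: LiuZhangZhang2018, Thm 1.5.1 and Thm 1.5.3 (Duke Math. J. 167 pp. 748–749)]
[cite: KellerYin2024b, Thm. 3.5.1 (arXiv:2410.23241 p. 20) (shape of H3; preprint)] -/
theorem gordTwoBranchIMC_of_kolyvagin_of_hsieh_of_lzz_of_exists_intDiv
    (hKo : ∀ (N : ℕ) [NeZero N] (W : WeierstrassCurve ℚ) (K : Type) [Field K] [NumberField K],
      Literature.NumberTheory.EllipticCurves.kolyvagin N W K)
    (hA : Hsieh2014.thmA_exists_isHsiehLFunction_unrPeriod_anyLevel)
    (hL : LiuZhangZhang2018.thm151_thm153_modularCurve_heegnerVector_additive)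
    (hG3 : ∀ (W : WeierstrassCurve ℚ) [W.IsElliptic] [W.IsGloballyMinimal] (p : ℕ) [Fact p.Prime],
      W.analyticRank = 1 → p ≠ 2 → ClassX3 W p → Additive.SubGordTwo W p →
      ∀ (N : ℕ) [NeZero N] (K : Type) [Field K] [NumberField K]
        (Dt : ModularParametrizationData W N) (H : HeegnerDatum N (NumberField.discr K)) (ι : K →+* ℂ)
        (P : (W.baseChange K).toAffine.Point),
        W.analyticRank = 1 → Additive.N10.Locus W p → W.conductorNorm ℤ = N → IsImaginaryQuadratic K →
        Odd (NumberField.discr K) → ¬ p ∣ Units.torsionOrder K → SatisfiesHeegnerHypothesis N K →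
        (W.quadraticTwist (NumberField.discr K : ℚ)).entireLFunction 1 ≠ 0 →
        WeierstrassCurve.Affine.Point.map ι.toRatAlgHom P = heegnerPointComplex Dt H →
        ¬ IsOfFinAddOrder P →
        ∀ (κ : ZpExtension K p), κ.IsAnticyclotomic →
          ∀ (γ : Field.absoluteGaloisGroup K) [Fact (κ.IsTopGenerator γ)]
            (𝔭 : HeightOneSpectrum (𝓞 K)), ((p : ℕ) : 𝓞 K) ∈ 𝔭.asIdeal →
            𝔭.asIdeal.ramificationIdx (𝓞 ℚ) = 1 → 𝔭.asIdeal.inertiaDeg (𝓞 ℚ) = 1 →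
            ∀ (ι' : PadicAlgCl p ≃+* ℂ), BranchInducesPrime p ι' 𝔭 →
              ∃ (ΩK : ℂ) (Ωp : ℂ_[p]) (Q : PowerSeries (PadicComplexInt p)), ΩK ≠ 0 ∧ Ωp ≠ 0 ∧
                R1.IsBDPLFunctionInt p ι' 𝔭 κ γ Dt.f ΩK Ωp Q ∧
                  (XAc.charIdeal (W.baseChange K) p κ 𝔭 ∅ γ).map (PowerSeries.map (R1.toCpInt p)) ≤
                    Ideal.span {Q}) :
    GordTwoBranchIMC :=
  gordTwoBranchIMC_of_kolyvagin_of_hsieh_of_lzz_of_intDiv hKo hA hL (intDiv_of_exists_frame (fun W _ _ p _ => Additive.SubGordTwo W p) hG3)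

end Summit.BirchSwinnertonDyer.BirchSwinnertonDyer.Theorems.SchneiderFreeAdditiveX3.ControlDischarged

end
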